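import Summits.ValiantsHypothesis.ValiantsHypothesis.Theorems.BarrierLeverTransversalMinorLayoutsRankFive

/-!
# Route BarrierLever — conjecture TT (`TransversalMinorLayoutsNonsingular`, stmt-ValiantsHypothesis-19152):
# a six-face complex without a vertex of degree one is a path

Helper file (`--supports stmt-ValiantsHypothesis-19152`; cell valiant-natproofs, rung V4, 𝒟-side of
door (c); seat val-np-p1 gen 8).  The partner of a `5`-claw in a locked pair with six faces has no
coordinate of degree `1` (the claw's degrees are all `1`).  `lowerFamily_six_eq_path`: a lower
family of exactly six sets in which no element lies in exactly one member consists of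
`∅, {a}, {b}, {c}, {a, b}, {a, c}` for distinct `a, b, c` — a PATH with centre `a` (members have
size `≤ 2` by `card_le_two_of_mem_lowerFamily`; some member is a pair `{a, b}`; of the two members
outside the four subsets of `{a, b}`, two singletons would give a degree-one element and two pairs
would coincide with `{a, b}`, so they are `{c}` and `{a, c}` or `{b, c}`).  The statement is given in
membership form (the two faces `{b}`, `{a, b}` and the list of all faces), which is what the cell
arguments of `…RankSix` consume.

WHAT THIS IS NOT: bookkeeping for bounded-rank slices of TT; nothing on TT / item 19761 in
general, on crux stmt-ValiantsHypothesis-14610, or on `VP` versus `VNP`.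
-/

-- layout Summits/ValiantsHypothesis/ValiantsHypothesis forces the duplicated namespace component
set_option linter.dupNamespace false

open Matrix Finset

namespace Summit.ValiantsHypothesis.ValiantsHypothesis.Theorems.BarrierLever.FiniteCheck

open Summit.ValiantsHypothesis.ValiantsHypothesis.Theorems.BarrierLever.Compression
open Summit.ValiantsHypothesis.ValiantsHypothesis.Theorems.BarrierLever.PriorityPeeling

/-! ## 3. Six faces without a vertex of degree one: the path -/

/-- A lower family of exactly six sets in which no element lies in exactly one member is a PATH
`{∅, {a}, {b}, {c}, {a, b}, {a, c}}` (`a, b, c` distinct). -/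
theorem lowerFamily_six_eq_path {h : ℕ} (F : Finset (Finset (Fin h)))
    (hlow : ∀ x ∈ F, ∀ t, t ⊆ x → t ∈ F) (hF : F.card = 6)
    (hdeg : ∀ c : Fin h, (F.filter fun x => c ∈ x).card ≠ 1) :
    ∃ a b c : Fin h, a ≠ b ∧ a ≠ c ∧ b ≠ c ∧ ({b} : Finset (Fin h)) ∈ F ∧ {a, b} ∈ F ∧
      ∀ y ∈ F, y = ∅ ∨ y = {a} ∨ y = {b} ∨ y = {c} ∨ y = {a, b} ∨ y = {a, c} := by
  classical
  have hle2 := card_le_two_of_mem_lowerFamily F hlow (by omega)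
  -- a nonempty member, and a singleton member lies in a pair member
  have hpairOf : ∀ c : Fin h, ({c} : Finset (Fin h)) ∈ F → ∃ y ∈ F, c ∈ y ∧ y.card = 2 := by
    intro c hc
    by_contra hno
    push Not at hno
    apply hdeg c
    rw [Finset.card_eq_one]
    refine ⟨{c}, Finset.eq_singleton_iff_unique_mem.mpr ⟨Finset.mem_filter.mpr ⟨hc, by simp⟩,
      fun y hy => ?_⟩⟩
    rw [Finset.mem_filter] at hy
    have hy2 := hno y hy.1 hy.2
    have hy1 : y.card ≤ 1 := by have := hle2 y hy.1; omega
    exact Finset.eq_singleton_iff_unique_mem.mpr ⟨hy.2, fun e he =>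
      Finset.card_le_one.mp hy1 e he c hy.2⟩
  -- some pair member exists
  obtain ⟨x, hxF, hx2⟩ : ∃ x ∈ F, x.card = 2 := by
    obtain ⟨x, hxF, hxne⟩ : ∃ x ∈ F, x ≠ ∅ := by
      by_contra hno
      push Not at hno
      have : F ⊆ {∅} := fun x hx => Finset.mem_singleton.mpr (hno x hx)
      have := Finset.card_le_card this
      rw [Finset.card_singleton, hF] at this
      omega
    obtain ⟨c, hc⟩ := Finset.nonempty_iff_ne_empty.mpr hxne
    obtain ⟨y, hyF, _, hy2⟩ := hpairOf c (hlow x hxF _ (Finset.singleton_subset_iff.mpr hc))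
    exact ⟨y, hyF, hy2⟩
  obtain ⟨a, b, hab, rfl⟩ := Finset.card_eq_two.mp hx2
  -- the four subsets of `{a, b}`
  set P : Finset (Finset (Fin h)) := {∅, {a}, {b}, {a, b}} with hPdef
  have hPF : P ⊆ F := by
    intro t ht
    simp only [hPdef, Finset.mem_insert, Finset.mem_singleton] at ht
    rcases ht with rfl | rfl | rfl | rfl
    · exact hlow _ hxF _ (Finset.empty_subset _)
    · exact hlow _ hxF _ (by simp)
    · exact hlow _ hxF _ (by simp)
    · exact hxF
  have hPcard : P.card = 4 := by
    have h1 : (∅ : Finset (Fin h)) ∉ ({{a}, {b}, {a, b}} : Finset (Finset (Fin h))) := by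
      simp only [Finset.mem_insert, Finset.mem_singleton, not_or]
      exact ⟨(Finset.singleton_ne_empty a).symm, (Finset.singleton_ne_empty b).symm,
        fun e => by simpa using (e.symm ▸ Finset.mem_insert_self a {b} : a ∈ (∅ : Finset _))⟩
    have h2 : ({a} : Finset (Fin h)) ∉ ({{b}, {a, b}} : Finset (Finset (Fin h))) := by
      simp only [Finset.mem_insert, Finset.mem_singleton, not_or]
      refine ⟨fun e => hab (Finset.singleton_injective e), fun e => hab ?_⟩
      have : b ∈ ({a} : Finset (Fin h)) := by rw [e]; simp
      exact (Finset.mem_singleton.mp this).symm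
    have h3 : ({b} : Finset (Fin h)) ≠ {a, b} := by
      intro e
      have : a ∈ ({b} : Finset (Fin h)) := by rw [e]; simp
      exact hab (Finset.mem_singleton.mp this)
    rw [hPdef, Finset.card_insert_of_notMem h1, Finset.card_insert_of_notMem h2,
      Finset.card_pair h3]
  -- singletons of a pair member are `{a}`, `{b}` or lie outside `P`
  have hsing : ∀ e : Fin h, ({e} : Finset (Fin h)) ∈ P → e = a ∨ e = b := by
    intro e he
    simp only [hPdef, Finset.mem_insert, Finset.mem_singleton] at he
    rcases he with he | he | he | he
    · exact absurd he (Finset.singleton_ne_empty e)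
    · exact Or.inl (Finset.singleton_injective he)
    · exact Or.inr (Finset.singleton_injective he)
    · exfalso
      have := congrArg Finset.card he
      rw [Finset.card_singleton, Finset.card_pair hab] at this
      omega
  -- the two members outside `P`
  have hdiff : (F \ P).card = 2 := by
    rw [Finset.card_sdiff_of_subset hPF, hF, hPcard]
  obtain ⟨f, g, hfg, hfgeq⟩ := Finset.card_eq_two.mp hdiff
  have hf : f ∈ F ∧ f ∉ P := Finset.mem_sdiff.mp (by rw [hfgeq]; simp)
  have hg : g ∈ F ∧ g ∉ P := Finset.mem_sdiff.mp (by rw [hfgeq]; simp)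
  have hFeq : F = insert f (insert g P) := by
    symm
    apply Finset.eq_of_subset_of_card_le
    · exact Finset.insert_subset hf.1 (Finset.insert_subset hg.1 hPF)
    · have hgP : g ∉ P := hg.2
      have hfP : f ∉ insert g P := by
        rw [Finset.mem_insert, not_or]; exact ⟨hfg, hf.2⟩
      rw [Finset.card_insert_of_notMem hfP, Finset.card_insert_of_notMem hgP, hPcard, hF]
  -- members outside P: nonempty, size ≤ 2
  have hout : ∀ y, y ∈ F → y ∉ P → (∃ c, y = {c} ∧ c ≠ a ∧ c ≠ b) ∨
      (y.card = 2 ∧ ∀ e ∈ y, ({e} : Finset (Fin h)) ∈ F) := by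
    intro y hyF hyP
    have hy2 := hle2 y hyF
    rcases Nat.lt_or_ge y.card 2 with hlt | hge
    · left
      rcases Nat.lt_or_ge y.card 1 with h0 | h1
      · exfalso; apply hyP
        rw [Finset.card_eq_zero.mp (show y.card = 0 by omega), hPdef]; simp
      · obtain ⟨c, rfl⟩ := Finset.card_eq_one.mp (show y.card = 1 by omega)
        refine ⟨c, rfl, fun e => hyP ?_, fun e => hyP ?_⟩
        · rw [e, hPdef]; simp
        · rw [e, hPdef]; simp
    · right
      exact ⟨le_antisymm hy2 hge, fun e he => hlow y hyF _ (Finset.singleton_subset_iff.mpr he)⟩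
  -- a pair member outside P has an element outside {a, b} whose singleton is the OTHER outsider
  have hpair_out : ∀ y z, y ∈ F → y ∉ P → z ∈ F → z ∉ P → y ≠ z → F = insert y (insert z P) →
      y.card = 2 → (∀ e ∈ y, ({e} : Finset (Fin h)) ∈ F) →
      ∃ c, z = {c} ∧ c ≠ a ∧ c ≠ b ∧ (y = {a, c} ∨ y = {b, c}) := by
    intro y z hyF hyP hzF hzP hyz hFyz hy2 hys
    obtain ⟨p, q, hpq, rfl⟩ := Finset.card_eq_two.mp hy2
    -- where do the singletons {p}, {q} live?
    have hloc : ∀ e ∈ ({p, q} : Finset (Fin h)), e = a ∨ e = b ∨ z = {e} := by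
      intro e he
      have h1 := hys e he
      rw [hFyz, Finset.mem_insert, Finset.mem_insert] at h1
      rcases h1 with h1 | h1 | h1
      · exfalso
        have := congrArg Finset.card h1
        rw [Finset.card_singleton, Finset.card_pair hpq] at this
        omega
      · exact Or.inr (Or.inr h1.symm)
      · rcases hsing e h1 with h | h
        · exact Or.inl h
        · exact Or.inr (Or.inl h)
    -- not both of p, q lie in {a, b}
    have hnotboth : ¬ ((p = a ∨ p = b) ∧ (q = a ∨ q = b)) := by
      rintro ⟨hp, hq⟩
      apply hyP
      have : ({p, q} : Finset (Fin h)) = {a, b} := by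
        apply Finset.eq_of_subset_of_card_le
        · intro e he
          simp only [Finset.mem_insert, Finset.mem_singleton] at he
          rcases he with rfl | rfl
          · rcases hp with rfl | rfl <;> simp
          · rcases hq with rfl | rfl <;> simp
        · rw [Finset.card_pair hab, Finset.card_pair hpq]
      rw [this, hPdef]; simp
    rcases hloc p (by simp) with hp | hp | hp
    · -- p = a, so z = {q}
      rcases hloc q (by simp) with hq | hq | hq
      · exact absurd ⟨Or.inl hp, Or.inl hq⟩ hnotboth
      · exact absurd ⟨Or.inl hp, Or.inr hq⟩ hnotboth
      · refine ⟨q, hq, fun e => hnotboth ⟨Or.inl hp, Or.inl e⟩,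
          fun e => hnotboth ⟨Or.inl hp, Or.inr e⟩, Or.inl ?_⟩
        rw [hp]
    · rcases hloc q (by simp) with hq | hq | hq
      · exact absurd ⟨Or.inr hp, Or.inl hq⟩ hnotboth
      · exact absurd ⟨Or.inr hp, Or.inr hq⟩ hnotboth
      · refine ⟨q, hq, fun e => hnotboth ⟨Or.inr hp, Or.inl e⟩,
          fun e => hnotboth ⟨Or.inr hp, Or.inr e⟩, Or.inr ?_⟩
        rw [hp]
    · -- z = {p}; then q must be a or b (else z = {q} too, so p = q)
      rcases hloc q (by simp) with hq | hq | hq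
      · refine ⟨p, hp, fun e => ?_, fun e => ?_, Or.inl ?_⟩
        · rcases hloc q (by simp) with hq' | hq' | hq'
          · exact hpq (e.trans hq'.symm)
          · exact hnotboth ⟨Or.inl e, Or.inr hq'⟩
          · have : ({p} : Finset (Fin h)) = {q} := hp.symm.trans hq'
            exact hpq (Finset.singleton_injective this)
        · exact hnotboth ⟨Or.inr e, Or.inl hq⟩
        · rw [hq, Finset.pair_comm]
      · refine ⟨p, hp, fun e => hnotboth ⟨Or.inl e, Or.inr hq⟩,
          fun e => hnotboth ⟨Or.inr e, Or.inr hq⟩, Or.inr ?_⟩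
        rw [hq, Finset.pair_comm]
      · exfalso
        have : ({p} : Finset (Fin h)) = {q} := hp.symm.trans hq
        exact hpq (Finset.singleton_injective this)
  -- how a (pair, singleton) description finishes the proof
  have hPmem : ∀ y, y ∈ P ↔ y = ∅ ∨ y = {a} ∨ y = {b} ∨ y = {a, b} := by
    intro y
    simp only [hPdef, Finset.mem_insert, Finset.mem_singleton]
  have finish : ∀ y z : Finset (Fin h), F = insert y (insert z P) → ∀ c : Fin h, z = {c} →
      c ≠ a → c ≠ b → (y = {a, c} ∨ y = {b, c}) →
      ∃ a b c : Fin h, a ≠ b ∧ a ≠ c ∧ b ≠ c ∧ ({b} : Finset (Fin h)) ∈ F ∧ {a, b} ∈ F ∧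
        ∀ y ∈ F, y = ∅ ∨ y = {a} ∨ y = {b} ∨ y = {c} ∨ y = {a, b} ∨ y = {a, c} := by
    intro y z hFyz c hz hca hcb hy
    have hmem : ∀ t, t ∈ F ↔ t = y ∨ t = z ∨ t ∈ P := by
      intro t; rw [hFyz, Finset.mem_insert, Finset.mem_insert]
    rcases hy with hy | hy
    · refine ⟨a, b, c, hab, fun e => hca e.symm, fun e => hcb e.symm,
        hPF (by rw [hPmem]; simp), hxF, fun t ht => ?_⟩
      rw [hmem, hPmem] at ht
      rcases ht with rfl | rfl | rfl | rfl | rfl | rfl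
      · exact Or.inr (Or.inr (Or.inr (Or.inr (Or.inr hy))))
      · exact Or.inr (Or.inr (Or.inr (Or.inl hz)))
      · exact Or.inl rfl
      · exact Or.inr (Or.inl rfl)
      · exact Or.inr (Or.inr (Or.inl rfl))
      · exact Or.inr (Or.inr (Or.inr (Or.inr (Or.inl rfl))))
    · refine ⟨b, a, c, hab.symm, fun e => hcb e.symm, fun e => hca e.symm,
        hPF (by rw [hPmem]; simp), by rw [Finset.pair_comm]; exact hxF, fun t ht => ?_⟩
      rw [hmem, hPmem] at ht
      rcases ht with rfl | rfl | rfl | rfl | rfl | rfl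
      · exact Or.inr (Or.inr (Or.inr (Or.inr (Or.inr hy))))
      · exact Or.inr (Or.inr (Or.inr (Or.inl hz)))
      · exact Or.inl rfl
      · exact Or.inr (Or.inr (Or.inl rfl))
      · exact Or.inr (Or.inl rfl)
      · exact Or.inr (Or.inr (Or.inr (Or.inr (Or.inl (Finset.pair_comm a b)))))
  -- case analysis on f and g
  rcases hout f hf.1 hf.2 with ⟨c, hfc, hca, hcb⟩ | ⟨hf2, hfs⟩
  · rcases hout g hg.1 hg.2 with ⟨d, hgd, hda, hdb⟩ | ⟨hg2, hgs⟩
    · -- two singletons: c has degree one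
      exfalso
      apply hdeg c
      rw [Finset.card_eq_one]
      refine ⟨f, ?_⟩
      ext y
      simp only [Finset.mem_filter, Finset.mem_singleton]
      constructor
      · rintro ⟨hyF, hcy⟩
        rw [hFeq, Finset.mem_insert, Finset.mem_insert] at hyF
        rcases hyF with rfl | rfl | hyP
        · rfl
        · exfalso
          rw [hgd, Finset.mem_singleton] at hcy
          apply hfg; rw [hfc, hgd, hcy]
        · exfalso
          simp only [hPdef, Finset.mem_insert, Finset.mem_singleton] at hyP
          rcases hyP with rfl | rfl | rfl | rfl
          · simp at hcy
          · exact hca (Finset.mem_singleton.mp hcy)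
          · exact hcb (Finset.mem_singleton.mp hcy)
          · simp only [Finset.mem_insert, Finset.mem_singleton] at hcy
            rcases hcy with e | e
            · exact hca e
            · exact hcb e
      · rintro rfl
        exact ⟨hf.1, by rw [hfc]; simp⟩
    · -- f = {c}, g a pair: g = {a,c} or {b,c}... via hpair_out with y = g, z = f
      have hFeq' : F = insert g (insert f P) := by rw [hFeq, Finset.insert_comm]
      obtain ⟨c', hfc', hc'a, hc'b, hgeq⟩ :=
        hpair_out g f hg.1 hg.2 hf.1 hf.2 hfg.symm hFeq' hg2 hgs
      exact finish g f hFeq' c' hfc' hc'a hc'b hgeq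
  · rcases hout g hg.1 hg.2 with ⟨d, hgd, hda, hdb⟩ | ⟨hg2, hgs⟩
    · obtain ⟨c', hgc', hc'a, hc'b, hfeq⟩ :=
        hpair_out f g hf.1 hf.2 hg.1 hg.2 hfg hFeq hf2 hfs
      exact finish f g hFeq c' hgc' hc'a hc'b hfeq
    · -- two pairs: impossible (f's singletons would lie in P, forcing f = {a,b})
      exfalso
      obtain ⟨c', hgc', -, -, -⟩ := hpair_out f g hf.1 hf.2 hg.1 hg.2 hfg hFeq hf2 hfs
      have := congrArg Finset.card hgc'
      rw [hg2, Finset.card_singleton] at this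
      omega

end Summit.ValiantsHypothesis.ValiantsHypothesis.Theorems.BarrierLever.FiniteCheck
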